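import Literature.NumberTheory.Transcendental.QuadraticRelationsLogarithmsSec4Torus
import Literature.NumberTheory.Transcendental.QuadraticRelationsLogarithmsSec5FF
import HarnessLib

/-!
# Roy–Waldschmidt 1997, proof of Théorème 4.1, step 2: lifting the torus relations

D. Roy, M. Waldschmidt, *Approximation diophantienne et indépendance algébrique de logarithmes*,
Ann. Sci. ÉNS (4) 30 (1997) 753–796, proof of Théorème 4.1, step 2), p. 777:

> pour tout `γ ∈ Σ'`, on a `π₁(γ) ∈ H₁ ⟺ π₁(γ̃) ∈ H₁`.

`torus_rel_of_reduction` proves the nontrivial implication for a tuple `u ∈ (𝒪^×)^{d₁}` of units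
of the valuation ring (the quotients `π₁(γδ⁻¹)`): if the reductions `ũⱼ = τ(uⱼ)` satisfy the
character relations `∏ ũⱼ^{χⱼ} = 1` (`χ ∈ M`) of the torus part of `H`, and
`2 T₁ ∑ⱼ 𝐡₁-bounds < D`, then `∏ uⱼ^{χⱼ} = 1` for all `χ ∈ M`.  Following the paper: for the
generators `ψ = α - β` of the box-difference lattice `Φ` the element `u^ψ - 1 ∈ 𝒪` has height
`< D` and reduces to `0`, hence vanishes (Lemme 4.2, `Place.lemme_4_2`); and every `φ ∈ M` has a
nonzero multiple in `Φ` (`exists_zsmul_mem_boxDiffLattice` of `…Sec4Torus.lean`, replacing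
Lemme 4.8), so `u^φ` is a root of unity reducing to `1`, hence equal to `1` (Lemme 4.2 again,
`u^φ - 1` being algebraic).  No named facts.

## References

* [RoyWaldschmidt1997ENS] D. Roy, M. Waldschmidt, Ann. Sci. ÉNS (4) 30 (1997) 753–796, proof of
  Théorème 4.1, step 2, p. 777; Lemme 4.2, p. 773.
-/

noncomputable section

open Complex

namespace Literature.NumberTheory.Transcendental

namespace RoyWaldschmidt1997

open Literature.NumberTheory.DiophantineGeometry
open Literature.NumberTheory.DiophantineGeometry.AlgFunctionField
open LinGroup LinGroup.ConnAlgSubgroup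

variable {K : IntermediateField ℚ ℂ}

/-- For a reduction map, `x ∈ 𝒪` with `τ(x) = 0` and `𝐡₁(x) < D` vanishes (Lemme 4.2).
[cite: RoyWaldschmidt1997ENS, Lemme 4.2, p. 773] -/
theorem eq_zero_of_isReduction_of_ffHeight₁_lt [IsAlgFunctionField ℚ K] (p : Place K)
    (τ : p.ring →+* ℂ) (hred : p.IsReduction τ) {x : K} (hx : x ∈ p.ring) (hτ : τ ⟨x, hx⟩ = 0)
    (h : ffHeight₁ (fun _ : Unit => x) < p.deg) : x = 0 := by
  by_contra hne
  obtain ⟨hmem, hres⟩ := p.lemme_4_2 hne h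
  apply hres
  rw [IsLocalRing.residue_eq_zero_iff]
  have hker : (⟨x, hmem⟩ : p.ring) ∈ RingHom.ker τ := by rw [RingHom.mem_ker]; exact hτ
  rw [show RingHom.ker τ = IsLocalRing.maximalIdeal p.ring from hred] at hker
  exact hker

/-- Heights of Laurent monomials in units: `𝐡₁(∏ uⱼ^{αⱼ} (uⱼ⁻¹)^{βⱼ}) ≤ ∑ⱼ (αⱼ + βⱼ) 𝐡₁(uⱼ)`
(`𝐡₁(u⁻¹) = 𝐡₁(u)`). [cite: RoyWaldschmidt1997ENS, §4, p. 777] -/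
theorem ffHeight₁_laurent_le [IsAlgFunctionField ℚ K] {d₁ : ℕ} (u : Fin d₁ → K) (α β : Fin d₁ → ℕ) :
    (ffHeight₁ (fun _ : Unit => (∏ j, u j ^ α j) * ∏ j, (u j)⁻¹ ^ β j) : ℤ) ≤
      ∑ j, ((α j + β j : ℕ) : ℤ) * ffHeight₁ (fun _ : Unit => u j) := by
  have h1 := affHeight_mul_le (k := ℚ) (∏ j, u j ^ α j) (∏ j, (u j)⁻¹ ^ β j)
  have h2 := ffHeight₁_prod_pow_le u α
  have h3 := ffHeight₁_prod_pow_le (fun j => (u j)⁻¹) β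
  have hinv : ∀ j, ffHeight₁ (fun _ : Unit => (u j)⁻¹) = ffHeight₁ (fun _ : Unit => u j) := by
    intro j
    have h := affHeight_inv (k := ℚ) (u j)
    rw [← natCast_ffHeight₁_single, ← natCast_ffHeight₁_single] at h
    exact_mod_cast h
  simp only [hinv] at h3
  rw [← natCast_ffHeight₁_single, ← natCast_ffHeight₁_single, ← natCast_ffHeight₁_single] at h1
  have h4 : (∑ j, ((α j + β j : ℕ) : ℤ) * ffHeight₁ (fun _ : Unit => u j)) =
      ((∑ j, α j * ffHeight₁ (fun _ : Unit => u j) : ℕ) : ℤ) + ((∑ j, β j * ffHeight₁ (fun _ : Unit => u j) : ℕ) : ℤ) := by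
    push_cast
    rw [← Finset.sum_add_distrib]
    refine Finset.sum_congr rfl fun j _ => by ring
  rw [h4]
  have h2' : ((ffHeight₁ (fun _ : Unit => ∏ j, u j ^ α j) : ℕ) : ℤ) ≤ ((∑ j, α j * ffHeight₁ (fun _ : Unit => u j) : ℕ) : ℤ) := by
    exact_mod_cast h2
  have h3' : ((ffHeight₁ (fun _ : Unit => ∏ j, (u j)⁻¹ ^ β j) : ℕ) : ℤ) ≤ ((∑ j, β j * ffHeight₁ (fun _ : Unit => u j) : ℕ) : ℤ) := by
    exact_mod_cast h3
  linarith

set_option maxHeartbeats 1600000 in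
/-- **Step 2 of the proof of Théorème 4.1** (`π₁(γ̃) ∈ H₁ ⟹ π₁(γ) ∈ H₁`): character relations
of the torus part of `H` lift from the reductions `ũ = τ(u)` of units `u ∈ (𝒪^×)^{d₁}` of small
height to `u` itself. [cite: RoyWaldschmidt1997ENS, proof of Théorème 4.1, step 2, p. 777] -/
theorem torus_rel_of_reduction [IsAlgFunctionField ℚ K] {d₀ d₁ : ℕ} (p : Place K) (τ : p.ring →+* ℂ)
    (hred : p.IsReduction τ) (H : ConnAlgSubgroup d₀ d₁) (T₁ : ℕ)
    (F : Set (MvPolynomial (Fin d₀ ⊕ Fin d₁) ℂ)) (hF : ∀ P ∈ F, ∀ i, P.degreeOf (Sum.inr i) ≤ T₁)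
    (hvan : ∀ g ∈ H.toSubgroup, ∀ P ∈ F, evalAt P g = 0)
    (hmax : ∀ H' : ConnAlgSubgroup d₀ d₁, H.toSubgroup ≤ H'.toSubgroup →
      (∀ g ∈ H'.toSubgroup, ∀ P ∈ F, evalAt P g = 0) → H'.toSubgroup = H.toSubgroup)
    (u : Fin d₁ → K) (hu0 : ∀ j, u j ≠ 0) (huO : ∀ j, u j ∈ p.ring) (huO' : ∀ j, (u j)⁻¹ ∈ p.ring)
    (h : Fin d₁ → ℕ) (hh : ∀ j, ffHeight₁ (fun _ : Unit => u j) ≤ h j) (hD : 2 * T₁ * ∑ j, h j < p.deg)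
    (hτ : ∀ χ ∈ H.chars, ∏ j, (τ ⟨u j, huO j⟩) ^ (χ j) = 1) :
    ∀ χ ∈ H.chars, ∏ j, (u j) ^ (χ j) = 1 := by
  classical
  -- the units `Uⱼ ∈ 𝒪` and their reductions
  have hτU0 : ∀ j, τ ⟨u j, huO j⟩ ≠ 0 := by
    intro j h0
    have h1 : (⟨u j, huO j⟩ : p.ring) * ⟨(u j)⁻¹, huO' j⟩ = 1 := Subtype.ext (mul_inv_cancel₀ (hu0 j))
    have h2 := congrArg τ h1
    rw [map_mul, h0, zero_mul, map_one] at h2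
    exact zero_ne_one h2
  have hτinv : ∀ j, τ ⟨(u j)⁻¹, huO' j⟩ = (τ ⟨u j, huO j⟩)⁻¹ := by
    intro j
    have h1 : (⟨(u j)⁻¹, huO' j⟩ : p.ring) * ⟨u j, huO j⟩ = 1 := Subtype.ext (inv_mul_cancel₀ (hu0 j))
    have h2 := congrArg τ h1
    rw [map_mul, map_one] at h2
    exact eq_inv_of_mul_eq_one_left h2
  /- (b) the relations hold for the generators `ψ = α - β` of `Φ`, hence on `Φ` -/
  have hgen : ∀ (α β : Fin d₁ → ℕ), (∀ j, α j ≤ T₁) → (∀ j, β j ≤ T₁) →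
      (fun j => (α j : ℤ) - β j) ∈ H.chars → (∏ j, u j ^ α j) * ∏ j, (u j)⁻¹ ^ β j = 1 := by
    intro α β hα hβ hψ
    set x : K := (∏ j, u j ^ α j) * ∏ j, (u j)⁻¹ ^ β j with hxdef
    -- `x ∈ 𝒪` with `τ(x) = ∏ τ(u)^ψ = 1`
    set X : p.ring := (∏ j, (⟨u j, huO j⟩ : p.ring) ^ α j) * ∏ j, (⟨(u j)⁻¹, huO' j⟩ : p.ring) ^ β j with hX
    have hXx : (X : K) = x := by rw [hX, hxdef]; push_cast; rfl
    have hτX : τ X = 1 := by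
      rw [hX, map_mul, map_prod, map_prod]
      simp only [map_pow, hτinv]
      have h1 := hτ _ hψ
      rw [← h1]
      rw [← Finset.prod_mul_distrib]
      refine Finset.prod_congr rfl fun j _ => ?_
      rw [zpow_sub₀ (hτU0 j), zpow_natCast, zpow_natCast, div_eq_mul_inv, inv_pow]
    -- heights: `𝐡₁(x - 1) ≤ 𝐡₁(x) ≤ 2 T₁ ∑ h < D`
    have hxh : (ffHeight₁ (fun _ : Unit => x - 1) : ℤ) < p.deg := by
      have h1 := affHeight_sub_one_le (k := ℚ) x
      rw [← natCast_ffHeight₁_single, ← natCast_ffHeight₁_single] at h1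
      have h2 := ffHeight₁_laurent_le u α β
      have h3 : (∑ j, ((α j + β j : ℕ) : ℤ) * ffHeight₁ (fun _ : Unit => u j)) ≤ 2 * T₁ * ∑ j, (h j : ℤ) := by
        rw [Finset.mul_sum]
        refine Finset.sum_le_sum fun j _ => ?_
        have h4 : ((α j + β j : ℕ) : ℤ) ≤ 2 * T₁ := by have := hα j; have := hβ j; push_cast; omega
        have h5 : (ffHeight₁ (fun _ : Unit => u j) : ℤ) ≤ h j := by exact_mod_cast hh j
        have h6 : (0 : ℤ) ≤ ffHeight₁ (fun _ : Unit => u j) := Nat.cast_nonneg _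
        nlinarith
      have h7 : ((2 * T₁ * ∑ j, h j : ℕ) : ℤ) < p.deg := by exact_mod_cast hD
      push_cast at h7
      rw [← hxdef] at h2
      linarith
    have hx1 : x - 1 ∈ p.ring := by rw [← hXx]; exact (X - 1).2
    have hτx1 : τ ⟨x - 1, hx1⟩ = 0 := by
      have e : (⟨x - 1, hx1⟩ : p.ring) = X - 1 := Subtype.ext (by
        show x - 1 = ((X - 1 : p.ring) : K)
        push_cast; rw [hXx])
      rw [e, map_sub, hτX, map_one, sub_self]
    have h0 := eq_zero_of_isReduction_of_ffHeight₁_lt p τ hred hx1 hτx1 (by exact_mod_cast hxh)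
    exact sub_eq_zero.mp h0
  have hΦ : ∀ ψ ∈ H.boxDiffLattice T₁, ∏ j, (u j) ^ (ψ j) = 1 := by
    intro ψ hψ
    induction hψ using AddSubgroup.closure_induction with
    | mem ψ hψ =>
      obtain ⟨α, β, hα, hβ, rfl, hmem⟩ := hψ
      have h1 := hgen α β hα hβ hmem
      rw [← h1, ← Finset.prod_mul_distrib]
      refine Finset.prod_congr rfl fun j _ => ?_
      rw [zpow_sub₀ (hu0 j), zpow_natCast, zpow_natCast, div_eq_mul_inv, inv_pow]
    | zero => simp
    | add ψ ψ' _ _ h1 h2 =>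
      simp only [Pi.add_apply, zpow_add₀ (hu0 _), Finset.prod_mul_distrib, h1, h2, mul_one]
    | neg ψ _ h1 =>
      simp only [Pi.neg_apply, zpow_neg, Finset.prod_inv_distrib, h1, inv_one]
  /- (c) saturation: `u^φ` is a root of unity reducing to `1` -/
  intro φ hφ
  obtain ⟨k, hk, hkφ⟩ := H.exists_zsmul_mem_boxDiffLattice T₁ F hF hvan hmax hφ
  set ζ : K := ∏ j, (u j) ^ (φ j) with hζ
  have hζk : ζ ^ k = 1 := by
    have h1 := hΦ _ hkφ
    rw [← h1, hζ, ← Finset.prod_zpow]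
    refine Finset.prod_congr rfl fun j _ => ?_
    rw [Pi.smul_apply, smul_eq_mul, mul_comm, zpow_mul]
  have hζ0 : ζ ≠ 0 := Finset.prod_ne_zero_iff.mpr fun j _ => zpow_ne_zero _ (hu0 j)
  -- `ζ` is algebraic (a root of unity)
  have hζalg : IsAlgebraic ℚ ζ := by
    have hn : ζ ^ k.natAbs = 1 := by
      rcases Int.natAbs_eq k with h1 | h1
      · have h2 : ζ ^ (k.natAbs : ℤ) = 1 := by rw [← h1]; exact hζk
        exact_mod_cast h2
      · have h2 : ζ ^ (-(k.natAbs : ℤ)) = 1 := by rw [← h1]; exact hζk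
        rw [zpow_neg, inv_eq_one] at h2
        exact_mod_cast h2
    have hkn : 0 < k.natAbs := Int.natAbs_pos.mpr hk
    refine ⟨Polynomial.X ^ k.natAbs - 1, ?_, ?_⟩
    · exact Polynomial.X_pow_sub_C_ne_zero hkn 1
    · simp [hn]
  -- `ζ ∈ 𝒪` with `τ(ζ) = ∏ τ(u)^φ = 1`
  set Z : p.ring := ∏ j, if 0 ≤ φ j then (⟨u j, huO j⟩ : p.ring) ^ (φ j).toNat
    else (⟨(u j)⁻¹, huO' j⟩ : p.ring) ^ (-(φ j)).toNat with hZ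
  have hpowj : ∀ j, (((if 0 ≤ φ j then (⟨u j, huO j⟩ : p.ring) ^ (φ j).toNat
      else (⟨(u j)⁻¹, huO' j⟩ : p.ring) ^ (-(φ j)).toNat) : p.ring) : K) = (u j) ^ (φ j) := by
    intro j
    split_ifs with hj
    · push_cast
      rw [← zpow_natCast, Int.toNat_of_nonneg hj]
    · push_cast
      rw [← zpow_natCast, inv_zpow', Int.toNat_of_nonneg (by omega), neg_neg]
  have hτpowj : ∀ j, τ (if 0 ≤ φ j then (⟨u j, huO j⟩ : p.ring) ^ (φ j).toNat
      else (⟨(u j)⁻¹, huO' j⟩ : p.ring) ^ (-(φ j)).toNat) = (τ ⟨u j, huO j⟩) ^ (φ j) := by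
    intro j
    split_ifs with hj
    · rw [map_pow, ← zpow_natCast, Int.toNat_of_nonneg hj]
    · rw [map_pow, hτinv, ← zpow_natCast, inv_zpow', Int.toNat_of_nonneg (by omega), neg_neg]
  have hZζ : (Z : K) = ζ := by
    rw [hZ, hζ]; push_cast
    exact Finset.prod_congr rfl fun j _ => hpowj j
  have hτZ : τ Z = 1 := by
    rw [hZ, map_prod]
    simp only [hτpowj]
    exact hτ φ hφ
  have hζ1mem : ζ - 1 ∈ p.ring := by rw [← hZζ]; exact (Z - 1).2
  have hτζ1 : τ ⟨ζ - 1, hζ1mem⟩ = 0 := by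
    have e : (⟨ζ - 1, hζ1mem⟩ : p.ring) = Z - 1 := Subtype.ext (by
      show ζ - 1 = ((Z - 1 : p.ring) : K)
      push_cast; rw [hZζ])
    rw [e, map_sub, hτZ, map_one, sub_self]
  have hh0 : ffHeight₁ (fun _ : Unit => ζ - 1) = 0 :=
    ffHeight₁_eq_zero_of_isAlgebraic fun _ => hζalg.sub isAlgebraic_one
  have h0 := eq_zero_of_isReduction_of_ffHeight₁_lt p τ hred hζ1mem hτζ1 (by rw [hh0]; exact p.deg_pos)
  exact sub_eq_zero.mp h0

end RoyWaldschmidt1997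

end Literature.NumberTheory.Transcendental
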